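import Mathlib
import HarnessLib
import Summits.Ventures.LatticeQCDFlow.Scoring.DoeblinPowerBatchMeansDeltaMethod
import Summits.Ventures.LatticeQCDFlow.Exactness.NCMCGeneralSpaceOccupancyChainErrorBars
import Summits.Ventures.LatticeQCDFlow.Exactness.NCMCGeneralSpaceIndicatorCLT

/-!
# The NCMC lane: the occupancy estimator `dF_occ = c − logit p̂` of the free-energy difference,
# STUDENTISED by its delta-method batch-means error bar, is asymptotically standard normal from
# any start — `√N (dF_occ − ΔF) / (σ̂_N /(p̂(1 − p̂))) ⇒ N(0, 1)`

HONEST FRAMING: exact (Metropolis-corrected) sampling algorithms for lattice gauge theory;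
figures of merit are autocorrelation/cost numbers at stated couplings and volumes; no
continuum-physics claim.

Venture `LatticeQCDFlow` (cell pub-lqcd), topic `Scoring`; FANOUT row 8 (`s0-cpn-nemc` — the
non-equilibrium (NCMC) lane is this seat's second object — GEN-22).  NEW WORK of the cell, not a
published result; no definition is introduced; nothing is cited as a fact.  THE OBJECT IS ROW 9's
NCMC iteration kernel `Q = switchKernel κF κR c W s e ∘ₖ levelKernel T₀ T₁` on the expanded ensemble
`Bool × Ω` under a `CrooksPair`, with invariant joint law `π_c` whose target-level mass is
`p = σ(c − ΔF)` (`Exactness/NCMCGeneralSpaceOccupancyChain.lean`), and with `Q²` minorised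
(`ε • ν ≤ (nHit Q 2)(z, ·)`, `Exactness/NCMCGeneralSpaceOccupancyChainDoeblin.lean`).  The engine
reports `dF_occ = c − log(p̂/(1 − p̂))`, `p̂` the occupancy fraction of the target level over
`N_n = b_n a_n` iterations; `…OccupancyChain.tendsto_dFocc_ae_chain` proved it strongly consistent
and `…OccupancyChainErrorBars.lean` bounded its deviations; row 13 also typed its CLT
(`…OccupancyChainCLT.CrooksPair.ncmc_dFocc_clt_of_sq`) and the coverage — at least nominal — of the
interval the engine REPORTS with a certified `τ̄ ≥ τ_int` (`…OccupancyChainCoverage.lean`).  This file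
gives the DATA-DRIVEN error bar with EXACT asymptotic coverage: by the
studentised delta method with the batch-means estimator under a Doeblin power
(`Scoring/DoeblinPowerBatchMeansDeltaMethod.doeblinPower_batchMeans_deltaMethod_clt`,
`φ = c − logit`, `φ'(p) = −1/(p(1−p))`, `φ(p) = ΔF` because `logit σ = id`), for EVERY initial
law of the expanded state and any `a_n, b_n → ∞`:
`√N_n (dF_occ − ΔF) / (σ̂_n / (p̂(1 − p̂))) ⇒ N(0, 1)`, `σ̂²_n` the batch-means estimator of the
asymptotic variance of the level-indicator series of the same run (`σ²_occ > 0` ASSUMED).  Printed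
counterparts NAMED ONLY: error bars for expanded-ensemble / NCMC free-energy estimators
(Lyubartsev et al. 1992; Nilmeier–Crooks–Minh–Chodera 2011), nothing cited as a fact.

## Content (hypotheses as in `…OccupancyChainErrorBars.lean`: `CrooksPair`, `ν₀ univ ≠ 0`,
## `ν₁ univ ≠ 0`, `e^{−ΔF} = ν₁(Ω)/ν₀(Ω)`, exact level samplers `T₀, T₁`, `ε ≠ 0`, `ε • ν ≤ Q²(z,·)`)

* **`ncmc_dFocc_studentized_clt`** — for `Y ~ N(0,1)`:
  `TendstoInDistribution (fun n x => √N_n ((c − log(p̂/(1−p̂))) − ΔF) / (|−1/(p̂(1−p̂))| √(σ̂²_n)))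
  atTop Y P_{μ₀}`;
* **`ncmc_dFocc_coverage`** — `z > 0`: `P_{μ₀} {|√N_n (dF_occ − ΔF)| / (σ̂_n/(p̂(1−p̂))) ≤ z} →
  (gaussianReal 0 1)[−z, z]`.

NOT CLAIMED: any value of `σ²_occ` or of the Doeblin constants for a concrete switch; the
degenerate case `σ²_occ = 0`; a rate; any number of ours.
-/

noncomputable section

namespace Summit.Ventures.LatticeQCDFlow.Scoring

open MeasureTheory ProbabilityTheory Set Filter Finset Literature.Probability.MarkovChains
open Summit.Ventures.LatticeQCDFlow.Exactness Summit.Ventures.LatticeQCDFlow.Exactness.GeneralNCMC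
open scoped ENNReal Topology

/-! ### The studentised occupancy estimator -/

section NCMC

variable {Ω E : Type*} [MeasurableSpace Ω] [MeasurableSpace E]
  {ν₀ ν₁ : Measure Ω} [IsFiniteMeasure ν₀] [IsFiniteMeasure ν₁]
  {κF κR : Kernel Ω E} [IsMarkovKernel κF] [IsMarkovKernel κR] {s e : E → Ω} {W : E → ℝ} {c : ℝ}
  {T₀ T₁ : Kernel Ω Ω} [IsMarkovKernel T₀] [IsMarkovKernel T₁] {ε : ℝ≥0∞}
  {ν : Measure (Bool × Ω)} [IsProbabilityMeasure ν]

/-- **THE STUDENTISED NCMC OCCUPANCY ESTIMATOR OF `ΔF` IS ASYMPTOTICALLY STANDARD NORMAL, FROM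
ANY START.**  `CrooksPair`, `ν₀(Ω), ν₁(Ω) ≠ 0`, `e^{−ΔF} = ν₁(Ω)/ν₀(Ω)`, exact level samplers,
`ε ≠ 0`, `ε • ν ≤ Q²(z, ·)`, the asymptotic variance `σ²_occ` of the level indicator positive,
`a_n, b_n → ∞`, `N_n = b_n a_n`, `p̂ = #{t < N_n : level_t = target}/N_n`; for `Y ~ N(0, 1)`:
`√N_n ((c − log(p̂/(1−p̂))) − ΔF) / (|−1/(p̂(1−p̂))| √(σ̂²_n)) ⇒ Y` under `P_{μ₀}`, every `μ₀`. -/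
theorem ncmc_dFocc_studentized_clt (h : CrooksPair ν₀ ν₁ κF κR s e W)
    (h0 : ν₀ univ ≠ 0) (h1 : ν₁ univ ≠ 0) (hT₀ : Kernel.Invariant T₀ ν₀)
    (hT₁ : Kernel.Invariant T₁ ν₁) (hε : ε ≠ 0)
    (hD : haveI := isMarkovKernel_switchKernel (κF := κF) (κR := κR) (c := c)
              h.measurable_W h.measurable_s h.measurable_e
      ∀ z, ε • ν ≤ nHit (switchKernel κF κR c W s e ∘ₖ levelKernel T₀ T₁) 2 z)
    {ΔF : ℝ} (hΔF : Real.exp (-ΔF) = ((ν₀ univ)⁻¹ * ν₁ univ).toReal)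
    (hσ : haveI := isMarkovKernel_switchKernel (κF := κF) (κR := κR) (c := c)
              h.measurable_W h.measurable_s h.measurable_e
      0 < ((∫ y, ((targetLevel Ω).indicator (1 : Bool × Ω → ℝ) y
              - ∫ z, (targetLevel Ω).indicator (1 : Bool × Ω → ℝ) z
                ∂((jointWeight c ν₀ ν₁ univ)⁻¹ • jointWeight c ν₀ ν₁)) ^ 2
            ∂((jointWeight c ν₀ ν₁ univ)⁻¹ • jointWeight c ν₀ ν₁))
          + 2 * ∑' k, ∫ y, ((targetLevel Ω).indicator (1 : Bool × Ω → ℝ) y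
              - ∫ z, (targetLevel Ω).indicator (1 : Bool × Ω → ℝ) z
                ∂((jointWeight c ν₀ ν₁ univ)⁻¹ • jointWeight c ν₀ ν₁))
            * (kop (switchKernel κF κR c W s e ∘ₖ levelKernel T₀ T₁))^[k + 1]
              (fun y => (targetLevel Ω).indicator (1 : Bool × Ω → ℝ) y
                - ∫ z, (targetLevel Ω).indicator (1 : Bool × Ω → ℝ) z
                  ∂((jointWeight c ν₀ ν₁ univ)⁻¹ • jointWeight c ν₀ ν₁)) y
            ∂((jointWeight c ν₀ ν₁ univ)⁻¹ • jointWeight c ν₀ ν₁)))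
    (μ₀ : Measure (Bool × Ω)) [IsProbabilityMeasure μ₀] {a b : ℕ → ℕ} (ha : Tendsto a atTop atTop)
    (hb : Tendsto b atTop atTop)
    {Ω' : Type*} [MeasurableSpace Ω'] {P' : Measure Ω'} [IsProbabilityMeasure P'] {Y : Ω' → ℝ}
    (hY : HasLaw Y (gaussianReal 0 1) P')
    [hP : haveI := isMarkovKernel_switchKernel (κF := κF) (κR := κR) (c := c)
              h.measurable_W h.measurable_s h.measurable_e
      haveI := isMarkovKernel_levelKernel T₀ T₁
      IsProbabilityMeasure (Kernel.trajMeasure (X := fun _ : ℕ => Bool × Ω) μ₀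
          (fun t : ℕ => (switchKernel κF κR c W s e ∘ₖ levelKernel T₀ T₁).comap
            (fun h : (i : ↥(Finset.Iic t)) → Bool × Ω => h ⟨t, Finset.mem_Iic.2 le_rfl⟩)
            (measurable_pi_apply _)))] :
    haveI := isMarkovKernel_switchKernel (κF := κF) (κR := κR) (c := c)
      h.measurable_W h.measurable_s h.measurable_e
    haveI := isMarkovKernel_levelKernel T₀ T₁
    TendstoInDistribution (fun (n : ℕ) (x : ℕ → Bool × Ω) =>
        Real.sqrt ((b n * a n : ℕ) : ℝ)
          * ((c - Real.log
              ((∑ t ∈ Finset.range (b n * a n), (targetLevel Ω).indicator (1 : Bool × Ω → ℝ) (x t))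
                  / ((b n * a n : ℕ) : ℝ)
                / (1 - (∑ t ∈ Finset.range (b n * a n),
                    (targetLevel Ω).indicator (1 : Bool × Ω → ℝ) (x t))
                  / ((b n * a n : ℕ) : ℝ))))
            - ΔF)
          / (|(-(1 / ((∑ t ∈ Finset.range (b n * a n),
              (targetLevel Ω).indicator (1 : Bool × Ω → ℝ) (x t))
                  / ((b n * a n : ℕ) : ℝ)
                * (1 - (∑ t ∈ Finset.range (b n * a n),
                    (targetLevel Ω).indicator (1 : Bool × Ω → ℝ) (x t))
                  / ((b n * a n : ℕ) : ℝ)))))|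
            * Real.sqrt (((b n * a n : ℕ) : ℝ) * replicaSEsq (fun j (x : ℕ → Bool × Ω) =>
              (∑ i ∈ Finset.range (b n),
                (targetLevel Ω).indicator (1 : Bool × Ω → ℝ) (x (b n * j + i)))
                / (b n)) (a n) x)))
      atTop Y (fun _ => (Kernel.trajMeasure (X := fun _ : ℕ => Bool × Ω) μ₀
          (fun t : ℕ => (switchKernel κF κR c W s e ∘ₖ levelKernel T₀ T₁).comap
            (fun h : (i : ↥(Finset.Iic t)) → Bool × Ω => h ⟨t, Finset.mem_Iic.2 le_rfl⟩)
            (measurable_pi_apply _)))) P' := by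
  haveI := isMarkovKernel_switchKernel (κF := κF) (κR := κR) (c := c)
    h.measurable_W h.measurable_s h.measurable_e
  haveI := isMarkovKernel_levelKernel T₀ T₁
  haveI := isProbabilityMeasure_jointLaw c ν₀ ν₁ h0
  obtain ⟨x0, -⟩ := nonempty_of_measure_ne_zero h0
  haveI : Nonempty (Bool × Ω) := ⟨(false, x0)⟩
  haveI := isMarkovKernel_nHit (switchKernel κF κR c W s e ∘ₖ levelKernel T₀ T₁) 2
  have hinv : Kernel.Invariant (switchKernel κF κR c W s e ∘ₖ levelKernel T₀ T₁)
      ((jointWeight c ν₀ ν₁ univ)⁻¹ • jointWeight c ν₀ ν₁) :=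
    invariant_smul _ (iteration_invariant h hT₀ hT₁ c) _
  have hε0 : 0 < ε := pos_iff_ne_zero.2 hε
  have hε1 : ε ≤ 1 := eps_le_one_of_minorised hD
  -- the observable: the target-level indicator, bounded by one, with mean `p = σ(c − ΔF) ∈ (0,1)`
  have hf : Measurable ((targetLevel Ω).indicator (1 : Bool × Ω → ℝ)) :=
    measurable_one.indicator measurableSet_targetLevel
  have hC : ∀ z, |(targetLevel Ω).indicator (1 : Bool × Ω → ℝ) z| ≤ 1 := fun z => by
    by_cases hz : z ∈ targetLevel Ω
    · simp [Set.indicator_of_mem hz]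
    · simp [Set.indicator_of_notMem hz]
  have hp : ∫ z, (targetLevel Ω).indicator (1 : Bool × Ω → ℝ) z
      ∂((jointWeight c ν₀ ν₁ univ)⁻¹ • jointWeight c ν₀ ν₁) = Real.sigmoid (c - ΔF) :=
    integral_jointLaw_targetLevel_indicator c ν₀ ν₁ h0 h1 hΔF
  have hp0 : 0 < Real.sigmoid (c - ΔF) := Real.sigmoid_pos _
  have hp1 : Real.sigmoid (c - ΔF) < 1 := Real.sigmoid_lt_one _
  have hp1' : (1 : ℝ) - Real.sigmoid (c - ΔF) ≠ 0 := (sub_pos.2 hp1).ne'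
  -- `φ = c − logit`, its derivative and the plug-in `D = −1/(q(1−q))`
  have hφ : HasDerivAt (fun q : ℝ => c - Real.log (q / (1 - q)))
      (-(1 / (Real.sigmoid (c - ΔF) * (1 - Real.sigmoid (c - ΔF)))))
      (∫ z, (targetLevel Ω).indicator (1 : Bool × Ω → ℝ) z
        ∂((jointWeight c ν₀ ν₁ univ)⁻¹ • jointWeight c ν₀ ν₁)) := by
    rw [hp]; exact (Exactness.GeneralNCMC.hasDerivAt_logit hp0 hp1).const_sub c
  have hφm : Measurable (fun q : ℝ => c - Real.log (q / (1 - q))) :=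
    measurable_const.sub (Real.measurable_log.comp (measurable_id.div (measurable_const.sub
      measurable_id)))
  have hd : -(1 / (Real.sigmoid (c - ΔF) * (1 - Real.sigmoid (c - ΔF)))) ≠ 0 :=
    neg_ne_zero.2 (one_div_ne_zero (mul_ne_zero hp0.ne' hp1'))
  have hDm : Measurable (fun q : ℝ => -(1 / (q * (1 - q)))) :=
    (measurable_const.div (measurable_id.mul (measurable_const.sub measurable_id))).neg
  have hDc : ContinuousAt (fun q : ℝ => -(1 / (q * (1 - q))))
      (∫ z, (targetLevel Ω).indicator (1 : Bool × Ω → ℝ) z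
        ∂((jointWeight c ν₀ ν₁ univ)⁻¹ • jointWeight c ν₀ ν₁)) := by
    rw [hp]
    exact (continuousAt_const.div (continuousAt_id.mul (continuousAt_const.sub continuousAt_id))
      (mul_ne_zero hp0.ne' hp1')).neg
  have hDu : (fun q : ℝ => -(1 / (q * (1 - q))))
      (∫ z, (targetLevel Ω).indicator (1 : Bool × Ω → ℝ) z
        ∂((jointWeight c ν₀ ν₁ univ)⁻¹ • jointWeight c ν₀ ν₁))
      = -(1 / (Real.sigmoid (c - ΔF) * (1 - Real.sigmoid (c - ΔF)))) := by
    simp only [hp]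
  -- `φ(p) = c − logit(σ(c − ΔF)) = ΔF`
  have hφp : c - Real.log
      ((∫ z, (targetLevel Ω).indicator (1 : Bool × Ω → ℝ) z
        ∂((jointWeight c ν₀ ν₁ univ)⁻¹ • jointWeight c ν₀ ν₁))
      / (1 - ∫ z, (targetLevel Ω).indicator (1 : Bool × Ω → ℝ) z
        ∂((jointWeight c ν₀ ν₁ univ)⁻¹ • jointWeight c ν₀ ν₁))) = ΔF := by
    rw [hp, log_sigmoid_div, sub_sub_cancel]
  have key := doeblinPower_batchMeans_deltaMethod_clt hinv hD hε0 hε1 two_pos hf hC hσ hφ hφm hd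
    hDm hDc hDu μ₀ ha hb hY
  rw [hφp] at key
  exact key

/-- **ASYMPTOTICALLY EXACT COVERAGE OF THE NCMC `ΔF` INTERVAL.**  Under the hypotheses of
`ncmc_dFocc_studentized_clt`, for every `z > 0`: the probability, from any initial law `μ₀` of the
expanded state, that `|√N_n (dF_occ − ΔF)| / (σ̂_n/(p̂(1−p̂))) ≤ z` tends to
`(gaussianReal 0 1)[−z, z]` — the interval `dF_occ ± z σ̂_n/(p̂(1−p̂)√N_n)` is asymptotically exact. -/
theorem ncmc_dFocc_coverage (h : CrooksPair ν₀ ν₁ κF κR s e W)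
    (h0 : ν₀ univ ≠ 0) (h1 : ν₁ univ ≠ 0) (hT₀ : Kernel.Invariant T₀ ν₀)
    (hT₁ : Kernel.Invariant T₁ ν₁) (hε : ε ≠ 0)
    (hD : haveI := isMarkovKernel_switchKernel (κF := κF) (κR := κR) (c := c)
              h.measurable_W h.measurable_s h.measurable_e
      ∀ z, ε • ν ≤ nHit (switchKernel κF κR c W s e ∘ₖ levelKernel T₀ T₁) 2 z)
    {ΔF : ℝ} (hΔF : Real.exp (-ΔF) = ((ν₀ univ)⁻¹ * ν₁ univ).toReal)
    (hσ : haveI := isMarkovKernel_switchKernel (κF := κF) (κR := κR) (c := c)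
              h.measurable_W h.measurable_s h.measurable_e
      0 < ((∫ y, ((targetLevel Ω).indicator (1 : Bool × Ω → ℝ) y
              - ∫ z, (targetLevel Ω).indicator (1 : Bool × Ω → ℝ) z
                ∂((jointWeight c ν₀ ν₁ univ)⁻¹ • jointWeight c ν₀ ν₁)) ^ 2
            ∂((jointWeight c ν₀ ν₁ univ)⁻¹ • jointWeight c ν₀ ν₁))
          + 2 * ∑' k, ∫ y, ((targetLevel Ω).indicator (1 : Bool × Ω → ℝ) y
              - ∫ z, (targetLevel Ω).indicator (1 : Bool × Ω → ℝ) z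
                ∂((jointWeight c ν₀ ν₁ univ)⁻¹ • jointWeight c ν₀ ν₁))
            * (kop (switchKernel κF κR c W s e ∘ₖ levelKernel T₀ T₁))^[k + 1]
              (fun y => (targetLevel Ω).indicator (1 : Bool × Ω → ℝ) y
                - ∫ z, (targetLevel Ω).indicator (1 : Bool × Ω → ℝ) z
                  ∂((jointWeight c ν₀ ν₁ univ)⁻¹ • jointWeight c ν₀ ν₁)) y
            ∂((jointWeight c ν₀ ν₁ univ)⁻¹ • jointWeight c ν₀ ν₁)))
    (μ₀ : Measure (Bool × Ω)) [IsProbabilityMeasure μ₀] {a b : ℕ → ℕ} (ha : Tendsto a atTop atTop)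
    (hb : Tendsto b atTop atTop)
    {z : ℝ} (hz : 0 < z)
    [hP : haveI := isMarkovKernel_switchKernel (κF := κF) (κR := κR) (c := c)
              h.measurable_W h.measurable_s h.measurable_e
      haveI := isMarkovKernel_levelKernel T₀ T₁
      IsProbabilityMeasure (Kernel.trajMeasure (X := fun _ : ℕ => Bool × Ω) μ₀
          (fun t : ℕ => (switchKernel κF κR c W s e ∘ₖ levelKernel T₀ T₁).comap
            (fun h : (i : ↥(Finset.Iic t)) → Bool × Ω => h ⟨t, Finset.mem_Iic.2 le_rfl⟩)
            (measurable_pi_apply _)))] :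
    haveI := isMarkovKernel_switchKernel (κF := κF) (κR := κR) (c := c)
      h.measurable_W h.measurable_s h.measurable_e
    haveI := isMarkovKernel_levelKernel T₀ T₁
    Tendsto (fun n : ℕ => (Kernel.trajMeasure (X := fun _ : ℕ => Bool × Ω) μ₀
          (fun t : ℕ => (switchKernel κF κR c W s e ∘ₖ levelKernel T₀ T₁).comap
            (fun h : (i : ↥(Finset.Iic t)) → Bool × Ω => h ⟨t, Finset.mem_Iic.2 le_rfl⟩)
            (measurable_pi_apply _))).real
      {x | |Real.sqrt ((b n * a n : ℕ) : ℝ)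
          * ((c - Real.log
              ((∑ t ∈ Finset.range (b n * a n), (targetLevel Ω).indicator (1 : Bool × Ω → ℝ) (x t))
                  / ((b n * a n : ℕ) : ℝ)
                / (1 - (∑ t ∈ Finset.range (b n * a n),
                    (targetLevel Ω).indicator (1 : Bool × Ω → ℝ) (x t))
                  / ((b n * a n : ℕ) : ℝ))))
            - ΔF)
          / (|(-(1 / ((∑ t ∈ Finset.range (b n * a n),
              (targetLevel Ω).indicator (1 : Bool × Ω → ℝ) (x t))
                  / ((b n * a n : ℕ) : ℝ)
                * (1 - (∑ t ∈ Finset.range (b n * a n),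
                    (targetLevel Ω).indicator (1 : Bool × Ω → ℝ) (x t))
                  / ((b n * a n : ℕ) : ℝ)))))|
            * Real.sqrt (((b n * a n : ℕ) : ℝ) * replicaSEsq (fun j (x : ℕ → Bool × Ω) =>
              (∑ i ∈ Finset.range (b n),
                (targetLevel Ω).indicator (1 : Bool × Ω → ℝ) (x (b n * j + i)))
                / (b n)) (a n) x))| ≤ z})
      atTop (𝓝 ((gaussianReal 0 1).real (Set.Icc (-z) z))) := by
  haveI := isMarkovKernel_switchKernel (κF := κF) (κR := κR) (c := c)
    h.measurable_W h.measurable_s h.measurable_e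
  haveI := isMarkovKernel_levelKernel T₀ T₁
  have hY : HasLaw (fun a : ℝ => a) (gaussianReal 0 1) (gaussianReal 0 1) :=
    ⟨aemeasurable_id', Measure.map_id'⟩
  have hclt := ncmc_dFocc_studentized_clt h h0 h1 hT₀ hT₁ hε hD hΔF hσ μ₀ ha hb hY
  have hE : ((gaussianReal 0 1).map (fun a : ℝ => a)) (frontier (Set.Icc (-z) z)) = 0 := by
    rw [Measure.map_id', frontier_Icc (by linarith)]
    haveI := nullSingletonClass_gaussianReal (μ := 0) one_ne_zero
    exact (Set.toFinite _).measure_zero _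
  have key := ProbabilityMeasure.tendsto_measure_of_null_frontier_of_tendsto' hclt.tendsto hE
  have key' := (ENNReal.tendsto_toReal (measure_ne_top _ (Set.Icc (-z) z))).comp key
  simp only [ProbabilityMeasure.coe_mk, Function.comp_def, Measure.map_id'] at key'
  simp only [measureReal_def]
  refine (tendsto_congr fun n => ?_).1 key'
  rw [Measure.map_apply_of_aemeasurable (hclt.forall_aemeasurable n) measurableSet_Icc]
  congr 2
  ext x
  simp only [Set.mem_preimage, Set.mem_Icc, Set.mem_setOf_eq, abs_le]

end NCMC

end Summit.Ventures.LatticeQCDFlow.Scoring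

end
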